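import Literature.Analysis.FluidPDE.FluidComputer.GalerkinEnergyBalance

/-!
# The scale-by-scale energy budget of the Galerkin system (Frisch (2.48), exactly, on the truncation)

Frisch's scale-by-scale energy budget equation [Frisch1995Turbulence, §2.4 eq. (2.48)–(2.52)],

  `∂_t 𝓔_K + Π_K = -2ν Ω_K + 𝓕_K`,

relates the cumulative energy `𝓔_K` below wavenumber `K`, the cumulative enstrophy `Ω_K`, the
cumulative injection `𝓕_K` and the energy flux `Π_K` through `K`; it "makes no use of probabilistic
tools" (loc. cit.). For the Galerkin-truncated system on a finite mode set `S = I ∪ O` (inside/outside a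
sphere, or ANY disjoint split) it holds EXACTLY along every solution, with the flux identified with the
typed shell-to-shell transfer of `ShellTransferIdentities`: `Π = T(I→O) = shellTransfer û O I`
(`flux_eq_shellTransfer`). This file differentiates in time what `ShellTransferIdentities` states at an
instant:

* `hasDerivAt_shellEnergy_galerkin` — for `K ⊆ S`: `dE_K/dt = -2νZ_K + T(S→K) + ε_in,K` with
  `T(S→K) = shellTransfer û K S` (energy received by `K` from all of `S`);
* `hasDerivAt_insideEnergy_galerkin` / `hasDerivAt_outsideEnergy_galerkin` — for `S = I ∪ O` disjoint:
  `dE_I/dt = -2νZ_I - Π + ε_in,I`, `dE_O/dt = -2νZ_O + Π + ε_in,O`, `Π = shellTransfer û O I` — (2.48);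
* `hasDerivAt_insideEnergy_euler` — unforced truncated Euler: `dE_I/dt = -Π`: the printed flux `Π(k,t)` of a
  diag row IS the instantaneous rate at which energy crosses the sphere in the exact system.

0 sorry, 0 named facts. HONEST FRAMING (cell pub-fluidc): typed infrastructure for a low prior, high
value-of-information experiment on Tao's machine paradigm; NOT a claim that NS blows up.
-/

noncomputable section

namespace Literature.Analysis.FluidPDE.FluidComputer

open Complex ComplexConjugate Finset
open scoped BigOperators

namespace ShellTransfer

/-- **Sub-shell energy equation**: along a Galerkin solution on `S`, for every `K ⊆ S`,
`dE_K/dt = -2ν Z_K + shellTransfer û K S + ε_in,K` (the transfer term no longer cancels: it is the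
energy received by `K` from the whole of `S`). [cite: Frisch1995Turbulence, §2.4 (2.46)–(2.48)] -/
theorem hasDerivAt_shellEnergy_galerkin {U : ℝ → FourierVelocity} {S : Finset (Fin 3 → ℤ)} {ν : ℝ}
    {c : ℝ → (Fin 3 → ℤ) → ℂ} {f : ℝ → (Fin 3 → ℤ) → Fin 3 → ℂ} (hU : IsGalerkinSolution U S ν c f)
    (t : ℝ) {K : Finset (Fin 3 → ℤ)} (hK : K ⊆ S) :
    HasDerivAt (fun s => truncEnergy (U s) K)
      (-(2 * ν) * truncEnstrophy (U t) K + shellTransfer (U t) K S + injectionRate (U t) (f t) K) t := by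
  have hs := HasDerivAt.sum (u := K) fun k hk => hasDerivAt_modalEnergy_galerkin hU t (hK hk)
  have e : (fun s => truncEnergy (U s) K) = ∑ k ∈ K, fun s => modalEnergy (U s) k := by
    funext s; simp only [truncEnergy, Finset.sum_apply]
  rw [e]
  refine hs.congr_deriv ?_
  rw [Finset.sum_add_distrib, Finset.sum_add_distrib]
  unfold truncEnstrophy injectionRate shellTransfer energyRate
  rw [Finset.mul_sum]
  congr 1
  congr 1
  refine Finset.sum_congr rfl fun k _ => ?_
  ring

/-- **FRISCH (2.48) ON THE TRUNCATION, inside**: for a disjoint split `S = I ∪ O`,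
`dE_I/dt = -2ν Z_I - Π + ε_in,I` with the flux `Π = T(I→O) = shellTransfer û O I`.
[cite: Frisch1995Turbulence, §2.4 eq. (2.48)–(2.52)] -/
theorem hasDerivAt_insideEnergy_galerkin {U : ℝ → FourierVelocity} {I O : Finset (Fin 3 → ℤ)}
    (h : Disjoint I O) {ν : ℝ} {c : ℝ → (Fin 3 → ℤ) → ℂ} {f : ℝ → (Fin 3 → ℤ) → Fin 3 → ℂ}
    (hU : IsGalerkinSolution U (I ∪ O) ν c f) (t : ℝ) :
    HasDerivAt (fun s => truncEnergy (U s) I)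
      (-(2 * ν) * truncEnstrophy (U t) I - shellTransfer (U t) O I + injectionRate (U t) (f t) I) t := by
  have h1 := hasDerivAt_shellEnergy_galerkin hU t (Finset.subset_union_left (s₁ := I) (s₂ := O))
  refine h1.congr_deriv ?_
  rw [shellTransfer_union_right (U t) I I O h, shellTransfer_self, zero_add, shellTransfer_antisymm (U t) I O]
  ring

/-- **FRISCH (2.48) ON THE TRUNCATION, outside**: `dE_O/dt = -2ν Z_O + Π + ε_in,O`, `Π = shellTransfer û O I`.
[cite: Frisch1995Turbulence, §2.4 eq. (2.48)–(2.52)] -/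
theorem hasDerivAt_outsideEnergy_galerkin {U : ℝ → FourierVelocity} {I O : Finset (Fin 3 → ℤ)}
    (h : Disjoint I O) {ν : ℝ} {c : ℝ → (Fin 3 → ℤ) → ℂ} {f : ℝ → (Fin 3 → ℤ) → Fin 3 → ℂ}
    (hU : IsGalerkinSolution U (I ∪ O) ν c f) (t : ℝ) :
    HasDerivAt (fun s => truncEnergy (U s) O)
      (-(2 * ν) * truncEnstrophy (U t) O + shellTransfer (U t) O I + injectionRate (U t) (f t) O) t := by
  have h1 := hasDerivAt_shellEnergy_galerkin hU t (Finset.subset_union_right (s₁ := I) (s₂ := O))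
  refine h1.congr_deriv ?_
  rw [shellTransfer_union_right (U t) O I O h, shellTransfer_self, add_zero]

/-- **Unforced truncated Euler: the flux IS the rate of energy crossing the split.** `dE_I/dt = -Π`,
`Π = shellTransfer û O I`. [cite: Frisch1995Turbulence, §2.4 eq. (2.48) with ν = 0, f = 0] -/
theorem hasDerivAt_insideEnergy_euler {U : ℝ → FourierVelocity} {I O : Finset (Fin 3 → ℤ)}
    (h : Disjoint I O) {c : ℝ → (Fin 3 → ℤ) → ℂ} (hU : IsGalerkinSolution U (I ∪ O) 0 c fun _ _ _ => 0)
    (t : ℝ) : HasDerivAt (fun s => truncEnergy (U s) I) (-shellTransfer (U t) O I) t := by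
  have h1 := hasDerivAt_insideEnergy_galerkin h hU t
  simp only [injectionRate_zero, mul_zero, neg_zero, zero_mul, zero_sub, add_zero] at h1
  exact h1

/-- … and `dE_O/dt = +Π`. [cite: Frisch1995Turbulence, §2.4 eq. (2.48) with ν = 0, f = 0] -/
theorem hasDerivAt_outsideEnergy_euler {U : ℝ → FourierVelocity} {I O : Finset (Fin 3 → ℤ)}
    (h : Disjoint I O) {c : ℝ → (Fin 3 → ℤ) → ℂ} (hU : IsGalerkinSolution U (I ∪ O) 0 c fun _ _ _ => 0)
    (t : ℝ) : HasDerivAt (fun s => truncEnergy (U s) O) (shellTransfer (U t) O I) t := by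
  have h1 := hasDerivAt_outsideEnergy_galerkin h hU t
  simp only [injectionRate_zero, mul_zero, neg_zero, zero_mul, zero_add, add_zero] at h1
  exact h1

/-- **Unforced viscous case, inside**: `dE_I/dt = -2νZ_I - Π` — the low-pass energy changes only by its
own dissipation and the flux through the split (what a diag row's `Π(k)` and `E(k' ≤ k)` columns must
jointly satisfy, up to time stepping and round-off). [cite: Frisch1995Turbulence, §2.4 eq. (2.48)] -/
theorem hasDerivAt_insideEnergy_unforced {U : ℝ → FourierVelocity} {I O : Finset (Fin 3 → ℤ)}
    (h : Disjoint I O) {ν : ℝ} {c : ℝ → (Fin 3 → ℤ) → ℂ}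
    (hU : IsGalerkinSolution U (I ∪ O) ν c fun _ _ _ => 0) (t : ℝ) :
    HasDerivAt (fun s => truncEnergy (U s) I)
      (-(2 * ν) * truncEnstrophy (U t) I - shellTransfer (U t) O I) t := by
  have h1 := hasDerivAt_insideEnergy_galerkin h hU t
  simp only [injectionRate_zero, add_zero] at h1
  exact h1

end ShellTransfer

end Literature.Analysis.FluidPDE.FluidComputer

end
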